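import Mathlib

/-!
# SoloBlind — pair lemma: rank-one (Feshbach / Sherman–Morrison) resolution of the column equation

In the PAIR WINDOW of LEMMA P (ENGINE-L-SPEC §6) the streak Green's matrix has a simple pole,
so the loop matrix splits as `L x = L_reg x + (v ⬝ᵥ x) • u` (regular part plus a rank-one pole
part).  If `N` inverts `1 - L_reg` (certified by ENGINE L⁺ on the regular part) and the scalar
`𝔡 = 1 - v ⬝ᵥ (N u)` does not vanish, the column equation `s = s₀ + L s` is solved explicitly:

* `pair_solution` : `s = N s₀ + c • N u` solves it whenever `c * 𝔡 = v ⬝ᵥ (N s₀)` (division-free form);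
* `pair_ker_trivial` : `x = L x` forces `x = 0` when `𝔡 ≠ 0`;
* `pair_isUnit_one_sub` : hence `1 - L` is invertible;
* `pair_existsUnique` : and the solution is unique, so it *is* the explicit one.

The zero set of `𝔡` (as a function of the spectral parameter) is the coupled pair eigenvalue that
the assembly encloses separately; these statements are the finite-dimensional algebra around it.
-/

namespace Summit.AnomalousDissipation.SoloBlind.PairFeshbach

open Matrix

variable {n : ℕ} {L Lr N : Matrix (Fin n) (Fin n) ℂ} {u v : Fin n → ℂ}

/-- Explicit solution (division-free form): if `(1 - L_reg) N = 1`, `L x = L_reg x + (v ⬝ᵥ x) • u`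
and `c (1 - v ⬝ᵥ N u) = v ⬝ᵥ N s₀`, then `s = N s₀ + c • N u` solves `s = s₀ + L s`. -/
theorem pair_solution (hN : (1 - Lr) * N = 1) (hL : ∀ x, L *ᵥ x = Lr *ᵥ x + (v ⬝ᵥ x) • u)
    (s₀ : Fin n → ℂ) {c : ℂ} (hc : c * (1 - v ⬝ᵥ (N *ᵥ u)) = v ⬝ᵥ (N *ᵥ s₀)) :
    N *ᵥ s₀ + c • (N *ᵥ u) = s₀ + L *ᵥ (N *ᵥ s₀ + c • (N *ᵥ u)) := by
  set s := N *ᵥ s₀ + c • (N *ᵥ u) with hs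
  -- (1 - L_reg) s = s₀ + c • u
  have h1 : (1 - Lr) *ᵥ s = s₀ + c • u := by
    rw [hs, mulVec_add, mulVec_smul, mulVec_mulVec, mulVec_mulVec, hN, one_mulVec, one_mulVec]
  -- v ⬝ᵥ s = c
  have h2 : v ⬝ᵥ s = c := by
    rw [hs, dotProduct_add, dotProduct_smul, smul_eq_mul]
    linear_combination -hc
  have h3 : s - Lr *ᵥ s = s₀ + c • u := by
    rw [← h1, sub_mulVec, one_mulVec]
  rw [hL s, h2]
  funext i
  have h4 := congrArg (fun f => f i) h3
  simp only [Pi.sub_apply, Pi.add_apply, Pi.smul_apply, smul_eq_mul] at h4 ⊢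
  linear_combination h4

/-- Trivial kernel: with `N (1 - L_reg) = 1` and `1 - v ⬝ᵥ N u ≠ 0`, the only solution of
`x = L x` is `x = 0`. -/
theorem pair_ker_trivial (hN' : N * (1 - Lr) = 1) (hL : ∀ x, L *ᵥ x = Lr *ᵥ x + (v ⬝ᵥ x) • u)
    (hd : 1 - v ⬝ᵥ (N *ᵥ u) ≠ 0) {x : Fin n → ℂ} (hx : x = L *ᵥ x) : x = 0 := by
  have h1 : (1 - Lr) *ᵥ x = (v ⬝ᵥ x) • u := by
    rw [sub_mulVec, one_mulVec]
    have h0 : x - Lr *ᵥ x = (v ⬝ᵥ x) • u := by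
      funext i
      have := congrArg (fun f => f i) hx
      rw [hL x] at this
      simp only [Pi.add_apply, Pi.smul_apply, smul_eq_mul, Pi.sub_apply] at this ⊢
      linear_combination this
    exact h0
  have h2 : x = (v ⬝ᵥ x) • (N *ᵥ u) := by
    calc x = (N * (1 - Lr)) *ᵥ x := by rw [hN', one_mulVec]
      _ = N *ᵥ ((1 - Lr) *ᵥ x) := by rw [mulVec_mulVec]
      _ = (v ⬝ᵥ x) • (N *ᵥ u) := by rw [h1, mulVec_smul]
  have h3 : v ⬝ᵥ x = (v ⬝ᵥ x) * (v ⬝ᵥ (N *ᵥ u)) := by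
    conv_lhs => rw [h2]
    rw [dotProduct_smul, smul_eq_mul]
  have h4 : (v ⬝ᵥ x) * (1 - v ⬝ᵥ (N *ᵥ u)) = 0 := by linear_combination h3
  have h5 : v ⬝ᵥ x = 0 := (mul_eq_zero.mp h4).resolve_right hd
  rw [h2, h5, zero_smul]

/-- `1 - L` is invertible in the pair window (rank-one Feshbach criterion). -/
theorem pair_isUnit_one_sub (hN' : N * (1 - Lr) = 1)
    (hL : ∀ x, L *ᵥ x = Lr *ᵥ x + (v ⬝ᵥ x) • u) (hd : 1 - v ⬝ᵥ (N *ᵥ u) ≠ 0) :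
    IsUnit (1 - L) := by
  rw [← mulVec_injective_iff_isUnit]
  intro a b hab
  have h : a - b = L *ᵥ (a - b) := by
    have h1 : a - L *ᵥ a = b - L *ᵥ b := by
      simpa only [sub_mulVec, one_mulVec] using hab
    rw [mulVec_sub]
    linear_combination h1
  exact sub_eq_zero.mp (pair_ker_trivial hN' hL hd h)

/-- Existence and uniqueness: with a two-sided inverse `N` of `1 - L_reg`, the splitting of `L`
and `𝔡 = 1 - v ⬝ᵥ N u ≠ 0`, the column equation has exactly one solution, namely the explicit
`N s₀ + (v ⬝ᵥ N s₀ / 𝔡) • N u`. -/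
theorem pair_existsUnique (hN : (1 - Lr) * N = 1) (hN' : N * (1 - Lr) = 1)
    (hL : ∀ x, L *ᵥ x = Lr *ᵥ x + (v ⬝ᵥ x) • u) (hd : 1 - v ⬝ᵥ (N *ᵥ u) ≠ 0)
    (s₀ : Fin n → ℂ) :
    ∃! s : Fin n → ℂ, s = s₀ + L *ᵥ s := by
  set c : ℂ := v ⬝ᵥ (N *ᵥ s₀) / (1 - v ⬝ᵥ (N *ᵥ u)) with hcdef
  have hc : c * (1 - v ⬝ᵥ (N *ᵥ u)) = v ⬝ᵥ (N *ᵥ s₀) := by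
    rw [hcdef, div_mul_cancel₀ _ hd]
  refine ⟨N *ᵥ s₀ + c • (N *ᵥ u), pair_solution hN hL s₀ hc, fun t ht => ?_⟩
  have hs := pair_solution hN hL s₀ hc
  have ht' : t = s₀ + L *ᵥ t := ht
  have h : t - (N *ᵥ s₀ + c • (N *ᵥ u)) = L *ᵥ (t - (N *ᵥ s₀ + c • (N *ᵥ u))) := by
    rw [mulVec_sub]
    linear_combination ht' - hs
  exact sub_eq_zero.mp (pair_ker_trivial hN' hL hd h)

end Summit.AnomalousDissipation.SoloBlind.PairFeshbach
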